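import Summits.QuantumFields.YangMills.Theorems.BalabanUVNodesN11TStepOldBranchPrivateInnerChartOfProvisos
import Summits.QuantumFields.YangMills.Theorems.BalabanUVNodesN11RePinnedOldBranchMeasurable

/-!
# DAG node N11 — THE (O3′) DISJUNCTION IN PRIVATE COORDINATES, IN `PresentChildObligations`' LETTERS (the graft) AND AT THE RE-PINNED PARAMETER `rePinH θ`: from `θ.Provisos₁₃CoPH`,
# Theorem 1's level-`k` form, dag-n11-w3's term rows, the per-bond inversion data, the support clause and THE integral identity `hinner₀` — NOTHING ELSE

HEADER — WORK-UNIT METADATA.  Cell `pub-ymgap`, YM-PLAN Track A (HUMAN RULING D-0062 ∕ D-0149), width seat `pub-ymgap-dag-n11-w2` (g4; WIDTH SEAT 2∕4 on N11 [B14]),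
route `BalabanUVNodes`; this seat's jail key is K1⁷ `stmt-QuantumFields-20542` (`--kind proof --supports 20542 --as helper`, count-neutral); the K1 face of record since
KEY MAP v2 is K1⁹ `StabilityBRunRowsAtRecordR13SepCoPHV` = stmt-QuantumFields-27364 (MIS-KEY ∕ VALID rule R463 (4)(a): lineage BY NAME).  [I] = [Balaban1987RG1], [III] =
[Balaban1988Convergent].  Sequel of this seat's `…TStepOldBranchPrivateInnerChartOfProvisos` (dag-n11-d's I `…PrivateInnerChartOfLaws` with every bookkeeping row discharged, rows ∕
term rows displayed) and of `…TStepOldBranchInnerSumAtRePinH` (the socket-free twin), over dag-n11-d's `…RePinnedParamDefs` (`rePinH`, `provisos₁₃CoPH_rePinH`) ∕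
`…RePinnedOldBranchMeasurable` (`measurable_zhAt_ζ0_rePinH_of_provisos`, `measurable_zhAt_quad_rePinH`), this seat's `termRowsAt_graftAboveB_all`, dag-n11-e's `graftAboveB`.  Bus: CLAIM-7 of g4.

WHY THIS FILE.  `PresentChildObligations θ p k t tnew EkN s′` states (O3′) for the GRAFT `graftAboveB k (t s′.init) (tnew s′)`; §1 reads its two operand rows from the term rows of the
OLD value `t s′.init` (levels `1 … k`) and of the RESPONSE `u = tnew s′` (levels `k`, `k+1`).  At the re-pinned parameter `rePinH θ` (where dag-n11-d's no-expansion lane serves its 𝐓-step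
and to which the K1 antecedent moves) the four residual-measurability rows are theorems (the certificate family's `ζ0` is built from `χ_j` and the resummed step weights, its `quad` is `0`),
so §2 ∕ §3 read the (O3′) disjunction with the inside step charted in dag-n11-w6's private coordinates from `θ.Provisos₁₃CoPH F N` + `hform` + the term rows + the per-bond inversion data
`(Ω, T, ϑ, jd; hΩm hTm hθm hjm hΩbl hright hlaw)` + `hβ′` + the support clause `hwS` + `hinner₀` — THE MATHEMATICS ([I] §2 + Jacobian + gauge fixing + `ζ` + [III] Thm 2) — only.

WHAT THIS FILE PROVES (0 `sorry`, 0 `def`, standard axioms).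
§1 ★★★★★★★ `O3_privateInnerChart_graft_of_provisos_of_termRows` (generic `θ`; the graft; four residual rows + two term-row families displayed).
§2 ★★★★★★★ `slotsTOfRecord₁₃H_succ_O3_of_hasSect2FormAtZS_of_privateInnerChart_rePinH_of_termRows` (any `(t′, E′)`; AT `rePinH θ`: residual rows GONE).
§3 ★★★★★★★ `O3_privateInnerChart_graft_rePinH_of_termRows` (the graft AT `rePinH θ`).

HONEST FRAMING.  Helper lane, count-neutral; ONE composition each, BY NAME; per-bond data, `hwS`, term rows, the level-`k` form and the integral identity DISPLAYED; NO chart of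
Bałaban's ((47), [III] (3.10)–(3.25)) asserted — dag-n11-w6's is a valid chart of the disintegration, not print's; NO Jacobian evaluated; NO Gaussian integration; nothing of [I] §2 ∕
[III] §3 ∕ Thm 2 asserted; (B4) ∕ (S-α) ∕ (O3′) NOT closed; N11 NOT discharged; K1⁹ NOT closed, no registered stub touched; counts unmoved (typed 28∕28 · discharged 5∕27 · A 5∕28).
One finite `𝕋⁴_{L^K}` programme at fixed `ε = L^{−K}`; R4 closes only the conditional finite-𝕋⁴ rung `BalabanLadder.UV` — NOT ℝ⁴, NOT OS, NOT a mass gap, NOT Clay.  No `sorry`,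
`axiom`, `def`, `instance`, `notation`.  Sources (SHAPE ∕ bookkeeping only): [I] (0.4) p.253, (2.4) p.266, (2.10) p.267; [III] Thm 1 p.262, Thm 2 p.263, §3 p.279, (2.18) p.257,
(2.20)–(2.21) p.258, (2.40)–(2.41) p.261, (3.1) p.264, (3.2)–(3.9) pp.265–266, (3.16) p.268, (3.24)–(3.25) p.270; [Balaban1989LargeFieldI] (0.2)–(0.3) p.176.
-/

noncomputable section

open MeasureTheory ProbabilityTheory Set Function
open scoped ENNReal NNReal BigOperators Matrix.Norms.L2Operator

namespace Summit.QuantumFields.YangMills.Theorems.BalabanUVNodesN11TStepOldBranchPrivateInnerChartAtRePinH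

open Literature.MathematicalPhysics.QuantumFieldTheory.Balaban1983to89
open Literature.MathematicalPhysics.QuantumFieldTheory.Balaban1983to89.T4AveragingDisintegration
open BalabanUVNodesN11TStepOldBranchPrivateInnerChartOfProvisos (slotsTOfRecord₁₃H_succ_O3_of_hasSect2FormAtZS_of_privateInnerChart_of_provisos_of_termRows)
open BalabanUVNodesN11OperandRowAtHistoryOfTermRows (termRowsAt_graftAboveB_all)
open BalabanUVNodesN11Sect3SupplySpliceOwnBoundary (graftAboveB)
open BalabanUVNodesN11Sect3SupplyChainTermRows (TermRowsAt)
open BalabanUVNodesN11RePinnedParamDefs (rePinH provisos₁₃CoPH_rePinH)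
open BalabanUVNodesN11RePinnedOldBranchMeasurable (measurable_zhAt_ζ0_rePinH_of_provisos measurable_zhAt_quad_rePinH)
open Literature.MathematicalPhysics.QuantumFieldTheory.Balaban1983to89.BlockAveragingHaarAC (centralBond)
open Node00 hiding SU
open Node00.Tk T4Continuum B14.Eq218Concrete
open B10Eq42TorusConstraint (bondsIn)

variable {F : T4Family} {N : ℕ} [NeZero N]

/-! ## §1  In `PresentChildObligations`' letters: the graft, generic `θ` -/

/-- ★★★★★★★ **THE (O3′) DISJUNCTION IN PRIVATE COORDINATES FOR THE GRAFT `graftAboveB k (t s′.init) u`** (`u := tnew s′`, `E′ := EkN s′`), generic `θ`: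
`…PrivateInnerChartOfProvisos`' `_of_provisos_of_termRows` at `t′ := graftAboveB k (t s′.init) u`, its term rows from those of `t s′.init` (levels `1 … k`) and of `u` (levels `k`, `k+1`)
by `termRowsAt_graftAboveB_all`. [cite: Balaban1988Convergent, Thm 2 p.263, §3 p.279, (3.24)–(3.25) p.270, (2.40)–(2.41) p.261; Balaban1987RG1, (0.4) p.253, (2.10) p.267] -/
theorem O3_privateInnerChart_graft_of_provisos_of_termRows (θ : Stage13HParams F N) (h : θ.Provisos₁₃CoPH F N)
    (p : B12.RunParams) {k : ℕ} (hkK : k < p.K)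
    {hdec : DecidableEq (PBond (F.P p.K) k)} {hdec' : DecidableEq (PBond (F.P p.K) (k + 1))} (hk : k + 1 ≤ (F.P p.K).m + (F.P p.K).K)
    (s' : SeqOfRecord F θ.ν θ.τ9.M (gOfRecord₁₃ F N θ.toStage13Params p) p.K (k + 1))
    {law : SeqOfRecord F θ.ν θ.τ9.M (gOfRecord₁₃ F N θ.toStage13Params p) p.K k → Sect2.TermValues (F.P p.K) (MatA N) (FluctV N) θ.τ9.M → Prop}
    {t : SeqOfRecord F θ.ν θ.τ9.M (gOfRecord₁₃ F N θ.toStage13Params p) p.K k → Sect2.TermValues (F.P p.K) (MatA N) (FluctV N) θ.τ9.M}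
    {Ek : SeqOfRecord F θ.ν θ.τ9.M (gOfRecord₁₃ F N θ.toStage13Params p) p.K k → ℝ}
    (hform : HasSect2FormAtZS F N (FluctV N) p.K (settingOfRecord₁₃ F N θ.toStage13Params p) k (θ.rzAt p) (WtOfRecord₁₃H F N θ p)
      (UbgOfRecord₁₃CoP F N θ.toStage13Params p k) law
      (slotsOfRecord F N θ.ν θ.τ9 (EOfRecord₁₃ F N θ.toStage13Params) (wOfRecord₉ F N θ.toStage9Params) θ.ppSel p (gOfRecord₁₃ F N θ.toStage13Params p) k) t Ek)
    (u : Sect2.TermValues (F.P p.K) (MatA N) (FluctV N) θ.τ9.M) (E' : ℝ)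
    -- measurability of the residuals serving `init s′` and `s′` (dag-n11-e's `ResidualRowsAt` shapes) + dag-n11-w3's TERM ROWS of the old value and of the RESPONSE `u`
    (hζ0m : ∀ j Y, Measurable ((θ.zhAt p s'.init).ζ0 j Y)) (hqm : ∀ j Λ', Measurable ((θ.zhAt p s'.init).quad j Λ'))
    (hζm : ∀ j Y, Measurable ((θ.zhAt p s').ζ0 j Y)) (hqm' : ∀ j Λ', Measurable ((θ.zhAt p s').quad j Λ'))
    (htrows₀ : ∀ j, 1 ≤ j → j ≤ k → TermRowsAt θ p (t s'.init) j) (hnew : ∀ j, k ≤ j → j ≤ k + 1 → TermRowsAt θ p u j)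
    -- dag-n11-w6 ∕ dag-n09-w6's per-bond inversion data of the (0.4) fibre maps, used only at the coarse bonds off `sV′`
    (hβ' : ∀ c : PBond (F.P p.K) (k + 1), c ∉ (Set.toFinite (bondsIn (k + 1) (s'.Ω (k + 1))ᶜ)).toFinset → centralBond c ∉ (Set.toFinite (bondsIn k (s'.Ω (k + 1))ᶜ)).toFinset)
    (Ω T : PBond (F.P p.K) (k + 1) → GaugeField (F.P p.K) k (SU N) → Set (SU N))
    (ϑ : PBond (F.P p.K) (k + 1) → GaugeField (F.P p.K) k (SU N) → SU N → SU N)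
    (jd : PBond (F.P p.K) (k + 1) → GaugeField (F.P p.K) k (SU N) → SU N → ℝ≥0)
    (hΩm : ∀ c, MeasurableSet {p : GaugeField (F.P p.K) k (SU N) × SU N | p.2 ∈ Ω c p.1})
    (hTm : ∀ c, MeasurableSet {p : GaugeField (F.P p.K) k (SU N) × SU N | p.2 ∈ T c p.1})
    (hθm : ∀ c, Measurable fun p : GaugeField (F.P p.K) k (SU N) × SU N => ϑ c p.1 p.2)
    (hjm : ∀ c, Measurable fun p : GaugeField (F.P p.K) k (SU N) × SU N => jd c p.1 p.2)
    (hΩbl : ∀ c (U : GaugeField (F.P p.K) k (SU N)) (g' : PBond (F.P p.K) (k + 1) → SU N), Ω c (extend centralBond g' U) = Ω c U)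
    (hright : ∀ c U, ∀ v ∈ T c U, (avOfRecord F N p.K k).avg (update U (centralBond c) (ϑ c U v)) c = v)
    (hlaw : ∀ c U, (HaarData.haar : Measure (SU N)).restrict (Ω c U) =
      (((HaarData.haar : Measure (SU N)).restrict (T c U)).withDensity fun v => (jd c U v : ℝ≥0∞)).map (ϑ c U))
    -- the support clause ((3.2)–(3.5))
    (hwS : ∀ q : (↥(Set.toFinite (bondsIn k (s'.Ω (k + 1))ᶜ)).toFinset → SU N) × ({b : PBond (F.P p.K) k // b ∉ (Set.toFinite (bondsIn k (s'.Ω (k + 1))ᶜ)).toFinset} → SU N),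
      wOfRecord₉ F N θ.toStage9Params p (gOfRecord₁₃ F N θ.toStage13Params p) k s' (⇑(MeasurableEquiv.piEquivPiSubtypeProd (fun _ : PBond (F.P p.K) k => SU N)
            (· ∈ (Set.toFinite (bondsIn k (s'.Ω (k + 1))ᶜ)).toFinset)).symm q) ((avOfRecord F N p.K k).avg (⇑(MeasurableEquiv.piEquivPiSubtypeProd (fun _ : PBond (F.P p.K) k => SU N)
            (· ∈ (Set.toFinite (bondsIn k (s'.Ω (k + 1))ᶜ)).toFinset)).symm q)) ≠ 0 →
        ∀ c : {c : PBond (F.P p.K) (k + 1) // c ∉ (Set.toFinite (bondsIn (k + 1) (s'.Ω (k + 1))ᶜ)).toFinset}, q.2 ⟨centralBond (c : PBond (F.P p.K) (k + 1)), hβ' c c.2⟩ ∈ Ω c ((MeasurableEquiv.piEquivPiSubtypeProd (fun _ : PBond (F.P p.K) k => SU N) (· ∈ (Set.toFinite (bondsIn k (s'.Ω (k + 1))ᶜ)).toFinset)).symm q))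
    -- THE EXPLICIT INTEGRAL IDENTITY PER OLD BRANCH ([I] §2 + gauge fixing + ζ + [III] Thm 2 — displayed)
    (hinner₀ : ∀ᵐ q ∂((Measure.pi fun _ : ↥(Set.toFinite (bondsIn (k + 1) (s'.Ω (k + 1))ᶜ)).toFinset => (HaarData.haar : Measure (SU N))).prod
          (Measure.pi fun _ : {c : PBond (F.P p.K) (k + 1) // c ∉ (Set.toFinite (bondsIn (k + 1) (s'.Ω (k + 1))ᶜ)).toFinset} =>
            (HaarData.haar : Measure (SU N)))),
      ∀ S₀ ∈ admSOfRecord F θ.ν θ.τ9.M (gOfRecord₁₃ F N θ.toStage13Params p) p.K k s'.init, ∀ y : ↥(Set.toFinite (bondsIn k (s'.Ω (k + 1))ᶜ)).toFinset → SU N,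
        avgRestrOfRecord F N p.K k (Set.toFinite (bondsIn k (s'.Ω (k + 1))ᶜ)).toFinset (Set.toFinite (bondsIn (k + 1) (s'.Ω (k + 1))ᶜ)).toFinset y = q.1 →
        (∫ r : ({b : PBond (F.P p.K) k // b ∉ (Set.toFinite (bondsIn k (s'.Ω (k + 1))ᶜ)).toFinset} → SU N), (({z : ((↥(Set.toFinite (bondsIn k (s'.Ω (k + 1))ᶜ)).toFinset → SU N) × ({c : PBond (F.P p.K) (k + 1) // c ∉ (Set.toFinite (bondsIn (k + 1) (s'.Ω (k + 1))ᶜ)).toFinset} → SU N)) × ({b : PBond (F.P p.K) k // b ∉ (Set.toFinite (bondsIn k (s'.Ω (k + 1))ᶜ)).toFinset} → SU N) |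
              ∀ c : {c : PBond (F.P p.K) (k + 1) // c ∉ (Set.toFinite (bondsIn (k + 1) (s'.Ω (k + 1))ᶜ)).toFinset}, z.1.2 c ∈ T c ((MeasurableEquiv.piEquivPiSubtypeProd (fun _ : PBond (F.P p.K) k => SU N) (· ∈ (Set.toFinite (bondsIn k (s'.Ω (k + 1))ᶜ)).toFinset)).symm (z.1.1, z.2))}.indicator
            (fun z => ∏ c : {c : PBond (F.P p.K) (k + 1) // c ∉ (Set.toFinite (bondsIn (k + 1) (s'.Ω (k + 1))ᶜ)).toFinset}, jd c ((MeasurableEquiv.piEquivPiSubtypeProd (fun _ : PBond (F.P p.K) k => SU N) (· ∈ (Set.toFinite (bondsIn k (s'.Ω (k + 1))ᶜ)).toFinset)).symm (z.1.1, z.2)) (z.1.2 c)) ((y, q.2), r) : ℝ≥0) : ℝ) *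
          ((fun U => wOfRecord₉ F N θ.toStage9Params p (gOfRecord₁₃ F N θ.toStage13Params p) k s' U ((avOfRecord F N p.K k).avg U) *
        (chiSeqOfRecord F N θ.ν θ.τ9.M (gOfRecord₁₃ F N θ.toStage13Params p) p.K k s'.init U *
          tkBranchOfRecord F N (FluctV N) θ.ν θ.τ9.M (gOfRecord₁₃ F N θ.toStage13Params p) p.K (WtOfRecord₁₃H F N θ p s'.init) s'.init S₀ k
            (fun ω => (sect2Operand F N (FluctV N) p.K (settingOfRecord₁₃ F N θ.toStage13Params p) (θ.rzAt p s'.init) s'.init (t s'.init) (Ek s'.init)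
            (UbgOfRecord₁₃CoP F N θ.toStage13Params p k s'.init)) (S₀, fun j => (ω j).2) (fun j => (ω j).1)) (baseCfg k U))) ∘
            ⇑(MeasurableEquiv.piEquivPiSubtypeProd (fun _ : PBond (F.P p.K) k => SU N)
            (· ∈ (Set.toFinite (bondsIn k (s'.Ω (k + 1))ᶜ)).toFinset)).symm) (y, extend (fun c : {c : PBond (F.P p.K) (k + 1) // c ∉ (Set.toFinite (bondsIn (k + 1) (s'.Ω (k + 1))ᶜ)).toFinset} =>
            (⟨centralBond (c : PBond (F.P p.K) (k + 1)), hβ' c c.2⟩ : {b : PBond (F.P p.K) k // b ∉ (Set.toFinite (bondsIn k (s'.Ω (k + 1))ᶜ)).toFinset}))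
            (fun c : {c : PBond (F.P p.K) (k + 1) // c ∉ (Set.toFinite (bondsIn (k + 1) (s'.Ω (k + 1))ᶜ)).toFinset} => ϑ c ((MeasurableEquiv.piEquivPiSubtypeProd (fun _ : PBond (F.P p.K) k => SU N) (· ∈ (Set.toFinite (bondsIn k (s'.Ω (k + 1))ᶜ)).toFinset)).symm (y, r)) (q.2 c)) r) ∂(Measure.pi fun _ : {b : PBond (F.P p.K) k // b ∉ (Set.toFinite (bondsIn k (s'.Ω (k + 1))ᶜ)).toFinset} => (HaarData.haar : Measure (SU N)))) =
          ∑ Y ∈ (Set.toFinite {Y : Set (Site (F.P p.K) 0) | Y ∈ SClassOfRecord F θ.ν (gOfRecord₁₃ F N θ.toStage13Params p) p.K (k + 1) ∧ Y ⊆ s'.Ω (k + 1) ∩ (s'.Λ (k + 1))ᶜ}).toFinset,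
            zetaOp (genDataOfRecord F N (FluctV N) θ.ν θ.τ9.M (gOfRecord₁₃ F N θ.toStage13Params p) p.K (WtOfRecord₁₃H F N θ p s') s' (Function.update S₀ (k + 1) Y) k).ζ
              (aOp k (genDataOfRecord F N (FluctV N) θ.ν θ.τ9.M (gOfRecord₁₃ F N θ.toStage13Params p) p.K (WtOfRecord₁₃H F N θ p s') s' (Function.update S₀ (k + 1) Y) k).sA
                (genDataOfRecord F N (FluctV N) θ.ν θ.τ9.M (gOfRecord₁₃ F N θ.toStage13Params p) p.K (WtOfRecord₁₃H F N θ p s') s' (Function.update S₀ (k + 1) Y) k).w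
                (tkBranchOfRecord F N (FluctV N) θ.ν θ.τ9.M (gOfRecord₁₃ F N θ.toStage13Params p) p.K (WtOfRecord₁₃H F N θ p s') s'.init S₀ k
                  (fun ω => (sect2Operand F N (FluctV N) p.K (settingOfRecord₁₃ F N θ.toStage13Params p) (θ.rzAt p s') s' (graftAboveB k (t s'.init) u) E'
                  (UbgOfRecord₁₃CoP F N θ.toStage13Params p (k + 1) s')) (Function.update S₀ (k + 1) Y, fun j => (ω j).2) (fun j => (ω j).1))))
              (Function.update (baseCfg (k + 1) ((MeasurableEquiv.piEquivPiSubtypeProd (fun _ : PBond (F.P p.K) (k + 1) => SU N)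
                (· ∈ (Set.toFinite (bondsIn (k + 1) (s'.Ω (k + 1))ᶜ)).toFinset)).symm q)) k
              (Function.updateFinset ((baseCfg (V := FluctV N) (k + 1) ((MeasurableEquiv.piEquivPiSubtypeProd (fun _ : PBond (F.P p.K) (k + 1) => SU N)
                (· ∈ (Set.toFinite (bondsIn (k + 1) (s'.Ω (k + 1))ᶜ)).toFinset)).symm q)) k).1 (Set.toFinite (bondsIn k (s'.Ω (k + 1))ᶜ)).toFinset y,
                ((baseCfg (V := FluctV N) (k + 1) ((MeasurableEquiv.piEquivPiSubtypeProd (fun _ : PBond (F.P p.K) (k + 1) => SU N)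
                (· ∈ (Set.toFinite (bondsIn (k + 1) (s'.Ω (k + 1))ᶜ)).toFinset)).symm q)) k).2))) :
    slotsTOfRecord F N θ.ν θ.τ9 (EOfRecord₁₃ F N θ.toStage13Params) (wOfRecord₉ F N θ.toStage9Params) θ.ppSel p (gOfRecord₁₃ F N θ.toStage13Params p) (k + 1) s' = 0 ∨
      ∀ᵐ V' ∂fieldMeasure (F.P p.K) (k + 1) (SU N),
        chiSeqOfRecord F N θ.ν θ.τ9.M (gOfRecord₁₃ F N θ.toStage13Params p) p.K (k + 1) s' V' ≠ 0 →
          slotsTOfRecord F N θ.ν θ.τ9 (EOfRecord₁₃ F N θ.toStage13Params) (wOfRecord₉ F N θ.toStage9Params) θ.ppSel p (gOfRecord₁₃ F N θ.toStage13Params p) (k + 1) s' V' =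
            sect2Slot F N (FluctV N) p.K (settingOfRecord₁₃ F N θ.toStage13Params p) (θ.rzAt p s') (WtOfRecord₁₃H F N θ p s') s' (graftAboveB k (t s'.init) u) E'
              (UbgOfRecord₁₃CoP F N θ.toStage13Params p (k + 1) s') V' :=
  slotsTOfRecord₁₃H_succ_O3_of_hasSect2FormAtZS_of_privateInnerChart_of_provisos_of_termRows θ h p hkK (hdec := hdec) (hdec' := hdec') hk s' hform
    (graftAboveB k (t s'.init) u) E' hζ0m hqm hζm hqm' htrows₀ (termRowsAt_graftAboveB_all k (t s'.init) u htrows₀ hnew)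
    hβ' Ω T ϑ jd hΩm hTm hθm hjm hΩbl hright hlaw hwS hinner₀

/-! ## §2  At the re-pinned parameter `rePinH θ`: no residual-measurability row -/

/-- ★★★★★★★ **THE (O3′) DISJUNCTION IN PRIVATE COORDINATES AT `rePinH θ`**, any proposed `(t′, E′)`: from `θ.Provisos₁₃CoPH F N`, `hform` at `rePinH θ`, the term rows of `t s′.init` and
`t′`, the per-bond inversion data + `hβ′`, the support clause `hwS`, and `hinner₀` — NOTHING ELSE.  `…PrivateInnerChartOfProvisos`' `_of_provisos_of_termRows` at `rePinH θ` with
`provisos₁₃CoPH_rePinH h` and dag-n11-d's `measurable_zhAt_ζ0_rePinH_of_provisos` ∕ `measurable_zhAt_quad_rePinH` at `init s′` and `s′`.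
[cite: Balaban1988Convergent, Thm 1 p.262, Thm 2 p.263, §3 p.279, (3.1) p.264, (3.24)–(3.25) p.270; Balaban1987RG1, (0.4) p.253, (2.10) p.267; Balaban1989LargeFieldI, (0.2)–(0.3) p.176] -/
theorem slotsTOfRecord₁₃H_succ_O3_of_hasSect2FormAtZS_of_privateInnerChart_rePinH_of_termRows (θ : Stage13HParams F N) (h : θ.Provisos₁₃CoPH F N)
    (p : B12.RunParams) {k : ℕ} (hkK : k < p.K)
    {hdec : DecidableEq (PBond (F.P p.K) k)} {hdec' : DecidableEq (PBond (F.P p.K) (k + 1))} (hk : k + 1 ≤ (F.P p.K).m + (F.P p.K).K)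
    (s' : SeqOfRecord F (rePinH θ).ν (rePinH θ).τ9.M (gOfRecord₁₃ F N (rePinH θ).toStage13Params p) p.K (k + 1))
    {law : SeqOfRecord F (rePinH θ).ν (rePinH θ).τ9.M (gOfRecord₁₃ F N (rePinH θ).toStage13Params p) p.K k → Sect2.TermValues (F.P p.K) (MatA N) (FluctV N) (rePinH θ).τ9.M → Prop}
    {t : SeqOfRecord F (rePinH θ).ν (rePinH θ).τ9.M (gOfRecord₁₃ F N (rePinH θ).toStage13Params p) p.K k → Sect2.TermValues (F.P p.K) (MatA N) (FluctV N) (rePinH θ).τ9.M}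
    {Ek : SeqOfRecord F (rePinH θ).ν (rePinH θ).τ9.M (gOfRecord₁₃ F N (rePinH θ).toStage13Params p) p.K k → ℝ}
    (hform : HasSect2FormAtZS F N (FluctV N) p.K (settingOfRecord₁₃ F N (rePinH θ).toStage13Params p) k ((rePinH θ).rzAt p) (WtOfRecord₁₃H F N (rePinH θ) p)
      (UbgOfRecord₁₃CoP F N (rePinH θ).toStage13Params p k) law
      (slotsOfRecord F N (rePinH θ).ν (rePinH θ).τ9 (EOfRecord₁₃ F N (rePinH θ).toStage13Params) (wOfRecord₉ F N (rePinH θ).toStage9Params) (rePinH θ).ppSel p (gOfRecord₁₃ F N (rePinH θ).toStage13Params p) k) t Ek)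
    (t' : Sect2.TermValues (F.P p.K) (MatA N) (FluctV N) (rePinH θ).τ9.M) (E' : ℝ)
    -- dag-n11-w3's TERM ROWS of the old witness value (levels `1 … k`) and of the proposed new one (levels `1 … k+1`)
    (htrows₀ : ∀ j, 1 ≤ j → j ≤ k → TermRowsAt (rePinH θ) p (t s'.init) j) (htrows : ∀ j, 1 ≤ j → j ≤ k + 1 → TermRowsAt (rePinH θ) p t' j)
    -- dag-n11-w6 ∕ dag-n09-w6's per-bond inversion data of the (0.4) fibre maps, used only at the coarse bonds off `sV′`
    (hβ' : ∀ c : PBond (F.P p.K) (k + 1), c ∉ (Set.toFinite (bondsIn (k + 1) (s'.Ω (k + 1))ᶜ)).toFinset → centralBond c ∉ (Set.toFinite (bondsIn k (s'.Ω (k + 1))ᶜ)).toFinset)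
    (Ω T : PBond (F.P p.K) (k + 1) → GaugeField (F.P p.K) k (SU N) → Set (SU N))
    (ϑ : PBond (F.P p.K) (k + 1) → GaugeField (F.P p.K) k (SU N) → SU N → SU N)
    (jd : PBond (F.P p.K) (k + 1) → GaugeField (F.P p.K) k (SU N) → SU N → ℝ≥0)
    (hΩm : ∀ c, MeasurableSet {p : GaugeField (F.P p.K) k (SU N) × SU N | p.2 ∈ Ω c p.1})
    (hTm : ∀ c, MeasurableSet {p : GaugeField (F.P p.K) k (SU N) × SU N | p.2 ∈ T c p.1})
    (hθm : ∀ c, Measurable fun p : GaugeField (F.P p.K) k (SU N) × SU N => ϑ c p.1 p.2)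
    (hjm : ∀ c, Measurable fun p : GaugeField (F.P p.K) k (SU N) × SU N => jd c p.1 p.2)
    (hΩbl : ∀ c (U : GaugeField (F.P p.K) k (SU N)) (g' : PBond (F.P p.K) (k + 1) → SU N), Ω c (extend centralBond g' U) = Ω c U)
    (hright : ∀ c U, ∀ v ∈ T c U, (avOfRecord F N p.K k).avg (update U (centralBond c) (ϑ c U v)) c = v)
    (hlaw : ∀ c U, (HaarData.haar : Measure (SU N)).restrict (Ω c U) =
      (((HaarData.haar : Measure (SU N)).restrict (T c U)).withDensity fun v => (jd c U v : ℝ≥0∞)).map (ϑ c U))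
    -- the support clause ((3.2)–(3.5))
    (hwS : ∀ q : (↥(Set.toFinite (bondsIn k (s'.Ω (k + 1))ᶜ)).toFinset → SU N) × ({b : PBond (F.P p.K) k // b ∉ (Set.toFinite (bondsIn k (s'.Ω (k + 1))ᶜ)).toFinset} → SU N),
      wOfRecord₉ F N (rePinH θ).toStage9Params p (gOfRecord₁₃ F N (rePinH θ).toStage13Params p) k s' (⇑(MeasurableEquiv.piEquivPiSubtypeProd (fun _ : PBond (F.P p.K) k => SU N)
            (· ∈ (Set.toFinite (bondsIn k (s'.Ω (k + 1))ᶜ)).toFinset)).symm q) ((avOfRecord F N p.K k).avg (⇑(MeasurableEquiv.piEquivPiSubtypeProd (fun _ : PBond (F.P p.K) k => SU N)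
            (· ∈ (Set.toFinite (bondsIn k (s'.Ω (k + 1))ᶜ)).toFinset)).symm q)) ≠ 0 →
        ∀ c : {c : PBond (F.P p.K) (k + 1) // c ∉ (Set.toFinite (bondsIn (k + 1) (s'.Ω (k + 1))ᶜ)).toFinset}, q.2 ⟨centralBond (c : PBond (F.P p.K) (k + 1)), hβ' c c.2⟩ ∈ Ω c ((MeasurableEquiv.piEquivPiSubtypeProd (fun _ : PBond (F.P p.K) k => SU N) (· ∈ (Set.toFinite (bondsIn k (s'.Ω (k + 1))ᶜ)).toFinset)).symm q))
    -- THE EXPLICIT INTEGRAL IDENTITY PER OLD BRANCH ([I] §2 + gauge fixing + ζ + [III] Thm 2 — displayed)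
    (hinner₀ : ∀ᵐ q ∂((Measure.pi fun _ : ↥(Set.toFinite (bondsIn (k + 1) (s'.Ω (k + 1))ᶜ)).toFinset => (HaarData.haar : Measure (SU N))).prod
          (Measure.pi fun _ : {c : PBond (F.P p.K) (k + 1) // c ∉ (Set.toFinite (bondsIn (k + 1) (s'.Ω (k + 1))ᶜ)).toFinset} =>
            (HaarData.haar : Measure (SU N)))),
      ∀ S₀ ∈ admSOfRecord F (rePinH θ).ν (rePinH θ).τ9.M (gOfRecord₁₃ F N (rePinH θ).toStage13Params p) p.K k s'.init, ∀ y : ↥(Set.toFinite (bondsIn k (s'.Ω (k + 1))ᶜ)).toFinset → SU N,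
        avgRestrOfRecord F N p.K k (Set.toFinite (bondsIn k (s'.Ω (k + 1))ᶜ)).toFinset (Set.toFinite (bondsIn (k + 1) (s'.Ω (k + 1))ᶜ)).toFinset y = q.1 →
        (∫ r : ({b : PBond (F.P p.K) k // b ∉ (Set.toFinite (bondsIn k (s'.Ω (k + 1))ᶜ)).toFinset} → SU N), (({z : ((↥(Set.toFinite (bondsIn k (s'.Ω (k + 1))ᶜ)).toFinset → SU N) × ({c : PBond (F.P p.K) (k + 1) // c ∉ (Set.toFinite (bondsIn (k + 1) (s'.Ω (k + 1))ᶜ)).toFinset} → SU N)) × ({b : PBond (F.P p.K) k // b ∉ (Set.toFinite (bondsIn k (s'.Ω (k + 1))ᶜ)).toFinset} → SU N) |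
              ∀ c : {c : PBond (F.P p.K) (k + 1) // c ∉ (Set.toFinite (bondsIn (k + 1) (s'.Ω (k + 1))ᶜ)).toFinset}, z.1.2 c ∈ T c ((MeasurableEquiv.piEquivPiSubtypeProd (fun _ : PBond (F.P p.K) k => SU N) (· ∈ (Set.toFinite (bondsIn k (s'.Ω (k + 1))ᶜ)).toFinset)).symm (z.1.1, z.2))}.indicator
            (fun z => ∏ c : {c : PBond (F.P p.K) (k + 1) // c ∉ (Set.toFinite (bondsIn (k + 1) (s'.Ω (k + 1))ᶜ)).toFinset}, jd c ((MeasurableEquiv.piEquivPiSubtypeProd (fun _ : PBond (F.P p.K) k => SU N) (· ∈ (Set.toFinite (bondsIn k (s'.Ω (k + 1))ᶜ)).toFinset)).symm (z.1.1, z.2)) (z.1.2 c)) ((y, q.2), r) : ℝ≥0) : ℝ) *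
          ((fun U => wOfRecord₉ F N (rePinH θ).toStage9Params p (gOfRecord₁₃ F N (rePinH θ).toStage13Params p) k s' U ((avOfRecord F N p.K k).avg U) *
        (chiSeqOfRecord F N (rePinH θ).ν (rePinH θ).τ9.M (gOfRecord₁₃ F N (rePinH θ).toStage13Params p) p.K k s'.init U *
          tkBranchOfRecord F N (FluctV N) (rePinH θ).ν (rePinH θ).τ9.M (gOfRecord₁₃ F N (rePinH θ).toStage13Params p) p.K (WtOfRecord₁₃H F N (rePinH θ) p s'.init) s'.init S₀ k
            (fun ω => (sect2Operand F N (FluctV N) p.K (settingOfRecord₁₃ F N (rePinH θ).toStage13Params p) ((rePinH θ).rzAt p s'.init) s'.init (t s'.init) (Ek s'.init)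
            (UbgOfRecord₁₃CoP F N (rePinH θ).toStage13Params p k s'.init)) (S₀, fun j => (ω j).2) (fun j => (ω j).1)) (baseCfg k U))) ∘
            ⇑(MeasurableEquiv.piEquivPiSubtypeProd (fun _ : PBond (F.P p.K) k => SU N)
            (· ∈ (Set.toFinite (bondsIn k (s'.Ω (k + 1))ᶜ)).toFinset)).symm) (y, extend (fun c : {c : PBond (F.P p.K) (k + 1) // c ∉ (Set.toFinite (bondsIn (k + 1) (s'.Ω (k + 1))ᶜ)).toFinset} =>
            (⟨centralBond (c : PBond (F.P p.K) (k + 1)), hβ' c c.2⟩ : {b : PBond (F.P p.K) k // b ∉ (Set.toFinite (bondsIn k (s'.Ω (k + 1))ᶜ)).toFinset}))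
            (fun c : {c : PBond (F.P p.K) (k + 1) // c ∉ (Set.toFinite (bondsIn (k + 1) (s'.Ω (k + 1))ᶜ)).toFinset} => ϑ c ((MeasurableEquiv.piEquivPiSubtypeProd (fun _ : PBond (F.P p.K) k => SU N) (· ∈ (Set.toFinite (bondsIn k (s'.Ω (k + 1))ᶜ)).toFinset)).symm (y, r)) (q.2 c)) r) ∂(Measure.pi fun _ : {b : PBond (F.P p.K) k // b ∉ (Set.toFinite (bondsIn k (s'.Ω (k + 1))ᶜ)).toFinset} => (HaarData.haar : Measure (SU N)))) =
          ∑ Y ∈ (Set.toFinite {Y : Set (Site (F.P p.K) 0) | Y ∈ SClassOfRecord F (rePinH θ).ν (gOfRecord₁₃ F N (rePinH θ).toStage13Params p) p.K (k + 1) ∧ Y ⊆ s'.Ω (k + 1) ∩ (s'.Λ (k + 1))ᶜ}).toFinset,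
            zetaOp (genDataOfRecord F N (FluctV N) (rePinH θ).ν (rePinH θ).τ9.M (gOfRecord₁₃ F N (rePinH θ).toStage13Params p) p.K (WtOfRecord₁₃H F N (rePinH θ) p s') s' (Function.update S₀ (k + 1) Y) k).ζ
              (aOp k (genDataOfRecord F N (FluctV N) (rePinH θ).ν (rePinH θ).τ9.M (gOfRecord₁₃ F N (rePinH θ).toStage13Params p) p.K (WtOfRecord₁₃H F N (rePinH θ) p s') s' (Function.update S₀ (k + 1) Y) k).sA
                (genDataOfRecord F N (FluctV N) (rePinH θ).ν (rePinH θ).τ9.M (gOfRecord₁₃ F N (rePinH θ).toStage13Params p) p.K (WtOfRecord₁₃H F N (rePinH θ) p s') s' (Function.update S₀ (k + 1) Y) k).w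
                (tkBranchOfRecord F N (FluctV N) (rePinH θ).ν (rePinH θ).τ9.M (gOfRecord₁₃ F N (rePinH θ).toStage13Params p) p.K (WtOfRecord₁₃H F N (rePinH θ) p s') s'.init S₀ k
                  (fun ω => (sect2Operand F N (FluctV N) p.K (settingOfRecord₁₃ F N (rePinH θ).toStage13Params p) ((rePinH θ).rzAt p s') s' t' E'
                  (UbgOfRecord₁₃CoP F N (rePinH θ).toStage13Params p (k + 1) s')) (Function.update S₀ (k + 1) Y, fun j => (ω j).2) (fun j => (ω j).1))))
              (Function.update (baseCfg (k + 1) ((MeasurableEquiv.piEquivPiSubtypeProd (fun _ : PBond (F.P p.K) (k + 1) => SU N)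
                (· ∈ (Set.toFinite (bondsIn (k + 1) (s'.Ω (k + 1))ᶜ)).toFinset)).symm q)) k
              (Function.updateFinset ((baseCfg (V := FluctV N) (k + 1) ((MeasurableEquiv.piEquivPiSubtypeProd (fun _ : PBond (F.P p.K) (k + 1) => SU N)
                (· ∈ (Set.toFinite (bondsIn (k + 1) (s'.Ω (k + 1))ᶜ)).toFinset)).symm q)) k).1 (Set.toFinite (bondsIn k (s'.Ω (k + 1))ᶜ)).toFinset y,
                ((baseCfg (V := FluctV N) (k + 1) ((MeasurableEquiv.piEquivPiSubtypeProd (fun _ : PBond (F.P p.K) (k + 1) => SU N)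
                (· ∈ (Set.toFinite (bondsIn (k + 1) (s'.Ω (k + 1))ᶜ)).toFinset)).symm q)) k).2))) :
    slotsTOfRecord F N (rePinH θ).ν (rePinH θ).τ9 (EOfRecord₁₃ F N (rePinH θ).toStage13Params) (wOfRecord₉ F N (rePinH θ).toStage9Params) (rePinH θ).ppSel p (gOfRecord₁₃ F N (rePinH θ).toStage13Params p) (k + 1) s' = 0 ∨
      ∀ᵐ V' ∂fieldMeasure (F.P p.K) (k + 1) (SU N),
        chiSeqOfRecord F N (rePinH θ).ν (rePinH θ).τ9.M (gOfRecord₁₃ F N (rePinH θ).toStage13Params p) p.K (k + 1) s' V' ≠ 0 →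
          slotsTOfRecord F N (rePinH θ).ν (rePinH θ).τ9 (EOfRecord₁₃ F N (rePinH θ).toStage13Params) (wOfRecord₉ F N (rePinH θ).toStage9Params) (rePinH θ).ppSel p (gOfRecord₁₃ F N (rePinH θ).toStage13Params p) (k + 1) s' V' =
            sect2Slot F N (FluctV N) p.K (settingOfRecord₁₃ F N (rePinH θ).toStage13Params p) ((rePinH θ).rzAt p s') (WtOfRecord₁₃H F N (rePinH θ) p s') s' t' E'
              (UbgOfRecord₁₃CoP F N (rePinH θ).toStage13Params p (k + 1) s') V' :=
  slotsTOfRecord₁₃H_succ_O3_of_hasSect2FormAtZS_of_privateInnerChart_of_provisos_of_termRows (rePinH θ) (provisos₁₃CoPH_rePinH h) p hkK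
    (hdec := hdec) (hdec' := hdec') hk s' hform t' E'
    (measurable_zhAt_ζ0_rePinH_of_provisos θ p h s'.init) (measurable_zhAt_quad_rePinH θ p s'.init)
    (measurable_zhAt_ζ0_rePinH_of_provisos θ p h s') (measurable_zhAt_quad_rePinH θ p s') htrows₀ htrows hβ' Ω T ϑ jd hΩm hTm hθm hjm hΩbl hright hlaw hwS hinner₀

/-! ## §3  At `rePinH θ`, in `PresentChildObligations`' letters -/

/-- ★★★★★★★ **THE (O3′) DISJUNCTION IN PRIVATE COORDINATES FOR THE GRAFT AT `rePinH θ`** — §1 at the re-pinned parameter.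
[cite: Balaban1988Convergent, Thm 2 p.263, §3 p.279, (3.24)–(3.25) p.270, (2.40)–(2.41) p.261; Balaban1989LargeFieldI, (0.2)–(0.3) p.176] -/
theorem O3_privateInnerChart_graft_rePinH_of_termRows (θ : Stage13HParams F N) (h : θ.Provisos₁₃CoPH F N)
    (p : B12.RunParams) {k : ℕ} (hkK : k < p.K)
    {hdec : DecidableEq (PBond (F.P p.K) k)} {hdec' : DecidableEq (PBond (F.P p.K) (k + 1))} (hk : k + 1 ≤ (F.P p.K).m + (F.P p.K).K)
    (s' : SeqOfRecord F (rePinH θ).ν (rePinH θ).τ9.M (gOfRecord₁₃ F N (rePinH θ).toStage13Params p) p.K (k + 1))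
    {law : SeqOfRecord F (rePinH θ).ν (rePinH θ).τ9.M (gOfRecord₁₃ F N (rePinH θ).toStage13Params p) p.K k → Sect2.TermValues (F.P p.K) (MatA N) (FluctV N) (rePinH θ).τ9.M → Prop}
    {t : SeqOfRecord F (rePinH θ).ν (rePinH θ).τ9.M (gOfRecord₁₃ F N (rePinH θ).toStage13Params p) p.K k → Sect2.TermValues (F.P p.K) (MatA N) (FluctV N) (rePinH θ).τ9.M}
    {Ek : SeqOfRecord F (rePinH θ).ν (rePinH θ).τ9.M (gOfRecord₁₃ F N (rePinH θ).toStage13Params p) p.K k → ℝ}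
    (hform : HasSect2FormAtZS F N (FluctV N) p.K (settingOfRecord₁₃ F N (rePinH θ).toStage13Params p) k ((rePinH θ).rzAt p) (WtOfRecord₁₃H F N (rePinH θ) p)
      (UbgOfRecord₁₃CoP F N (rePinH θ).toStage13Params p k) law
      (slotsOfRecord F N (rePinH θ).ν (rePinH θ).τ9 (EOfRecord₁₃ F N (rePinH θ).toStage13Params) (wOfRecord₉ F N (rePinH θ).toStage9Params) (rePinH θ).ppSel p (gOfRecord₁₃ F N (rePinH θ).toStage13Params p) k) t Ek)
    (u : Sect2.TermValues (F.P p.K) (MatA N) (FluctV N) (rePinH θ).τ9.M) (E' : ℝ)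
    -- dag-n11-w3's TERM ROWS of the old value and of the RESPONSE `u`
    (htrows₀ : ∀ j, 1 ≤ j → j ≤ k → TermRowsAt (rePinH θ) p (t s'.init) j) (hnew : ∀ j, k ≤ j → j ≤ k + 1 → TermRowsAt (rePinH θ) p u j)
    -- dag-n11-w6 ∕ dag-n09-w6's per-bond inversion data of the (0.4) fibre maps, used only at the coarse bonds off `sV′`
    (hβ' : ∀ c : PBond (F.P p.K) (k + 1), c ∉ (Set.toFinite (bondsIn (k + 1) (s'.Ω (k + 1))ᶜ)).toFinset → centralBond c ∉ (Set.toFinite (bondsIn k (s'.Ω (k + 1))ᶜ)).toFinset)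
    (Ω T : PBond (F.P p.K) (k + 1) → GaugeField (F.P p.K) k (SU N) → Set (SU N))
    (ϑ : PBond (F.P p.K) (k + 1) → GaugeField (F.P p.K) k (SU N) → SU N → SU N)
    (jd : PBond (F.P p.K) (k + 1) → GaugeField (F.P p.K) k (SU N) → SU N → ℝ≥0)
    (hΩm : ∀ c, MeasurableSet {p : GaugeField (F.P p.K) k (SU N) × SU N | p.2 ∈ Ω c p.1})
    (hTm : ∀ c, MeasurableSet {p : GaugeField (F.P p.K) k (SU N) × SU N | p.2 ∈ T c p.1})
    (hθm : ∀ c, Measurable fun p : GaugeField (F.P p.K) k (SU N) × SU N => ϑ c p.1 p.2)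
    (hjm : ∀ c, Measurable fun p : GaugeField (F.P p.K) k (SU N) × SU N => jd c p.1 p.2)
    (hΩbl : ∀ c (U : GaugeField (F.P p.K) k (SU N)) (g' : PBond (F.P p.K) (k + 1) → SU N), Ω c (extend centralBond g' U) = Ω c U)
    (hright : ∀ c U, ∀ v ∈ T c U, (avOfRecord F N p.K k).avg (update U (centralBond c) (ϑ c U v)) c = v)
    (hlaw : ∀ c U, (HaarData.haar : Measure (SU N)).restrict (Ω c U) =
      (((HaarData.haar : Measure (SU N)).restrict (T c U)).withDensity fun v => (jd c U v : ℝ≥0∞)).map (ϑ c U))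
    -- the support clause ((3.2)–(3.5))
    (hwS : ∀ q : (↥(Set.toFinite (bondsIn k (s'.Ω (k + 1))ᶜ)).toFinset → SU N) × ({b : PBond (F.P p.K) k // b ∉ (Set.toFinite (bondsIn k (s'.Ω (k + 1))ᶜ)).toFinset} → SU N),
      wOfRecord₉ F N (rePinH θ).toStage9Params p (gOfRecord₁₃ F N (rePinH θ).toStage13Params p) k s' (⇑(MeasurableEquiv.piEquivPiSubtypeProd (fun _ : PBond (F.P p.K) k => SU N)
            (· ∈ (Set.toFinite (bondsIn k (s'.Ω (k + 1))ᶜ)).toFinset)).symm q) ((avOfRecord F N p.K k).avg (⇑(MeasurableEquiv.piEquivPiSubtypeProd (fun _ : PBond (F.P p.K) k => SU N)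
            (· ∈ (Set.toFinite (bondsIn k (s'.Ω (k + 1))ᶜ)).toFinset)).symm q)) ≠ 0 →
        ∀ c : {c : PBond (F.P p.K) (k + 1) // c ∉ (Set.toFinite (bondsIn (k + 1) (s'.Ω (k + 1))ᶜ)).toFinset}, q.2 ⟨centralBond (c : PBond (F.P p.K) (k + 1)), hβ' c c.2⟩ ∈ Ω c ((MeasurableEquiv.piEquivPiSubtypeProd (fun _ : PBond (F.P p.K) k => SU N) (· ∈ (Set.toFinite (bondsIn k (s'.Ω (k + 1))ᶜ)).toFinset)).symm q))
    -- THE EXPLICIT INTEGRAL IDENTITY PER OLD BRANCH ([I] §2 + gauge fixing + ζ + [III] Thm 2 — displayed)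
    (hinner₀ : ∀ᵐ q ∂((Measure.pi fun _ : ↥(Set.toFinite (bondsIn (k + 1) (s'.Ω (k + 1))ᶜ)).toFinset => (HaarData.haar : Measure (SU N))).prod
          (Measure.pi fun _ : {c : PBond (F.P p.K) (k + 1) // c ∉ (Set.toFinite (bondsIn (k + 1) (s'.Ω (k + 1))ᶜ)).toFinset} =>
            (HaarData.haar : Measure (SU N)))),
      ∀ S₀ ∈ admSOfRecord F (rePinH θ).ν (rePinH θ).τ9.M (gOfRecord₁₃ F N (rePinH θ).toStage13Params p) p.K k s'.init, ∀ y : ↥(Set.toFinite (bondsIn k (s'.Ω (k + 1))ᶜ)).toFinset → SU N,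
        avgRestrOfRecord F N p.K k (Set.toFinite (bondsIn k (s'.Ω (k + 1))ᶜ)).toFinset (Set.toFinite (bondsIn (k + 1) (s'.Ω (k + 1))ᶜ)).toFinset y = q.1 →
        (∫ r : ({b : PBond (F.P p.K) k // b ∉ (Set.toFinite (bondsIn k (s'.Ω (k + 1))ᶜ)).toFinset} → SU N), (({z : ((↥(Set.toFinite (bondsIn k (s'.Ω (k + 1))ᶜ)).toFinset → SU N) × ({c : PBond (F.P p.K) (k + 1) // c ∉ (Set.toFinite (bondsIn (k + 1) (s'.Ω (k + 1))ᶜ)).toFinset} → SU N)) × ({b : PBond (F.P p.K) k // b ∉ (Set.toFinite (bondsIn k (s'.Ω (k + 1))ᶜ)).toFinset} → SU N) |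
              ∀ c : {c : PBond (F.P p.K) (k + 1) // c ∉ (Set.toFinite (bondsIn (k + 1) (s'.Ω (k + 1))ᶜ)).toFinset}, z.1.2 c ∈ T c ((MeasurableEquiv.piEquivPiSubtypeProd (fun _ : PBond (F.P p.K) k => SU N) (· ∈ (Set.toFinite (bondsIn k (s'.Ω (k + 1))ᶜ)).toFinset)).symm (z.1.1, z.2))}.indicator
            (fun z => ∏ c : {c : PBond (F.P p.K) (k + 1) // c ∉ (Set.toFinite (bondsIn (k + 1) (s'.Ω (k + 1))ᶜ)).toFinset}, jd c ((MeasurableEquiv.piEquivPiSubtypeProd (fun _ : PBond (F.P p.K) k => SU N) (· ∈ (Set.toFinite (bondsIn k (s'.Ω (k + 1))ᶜ)).toFinset)).symm (z.1.1, z.2)) (z.1.2 c)) ((y, q.2), r) : ℝ≥0) : ℝ) *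
          ((fun U => wOfRecord₉ F N (rePinH θ).toStage9Params p (gOfRecord₁₃ F N (rePinH θ).toStage13Params p) k s' U ((avOfRecord F N p.K k).avg U) *
        (chiSeqOfRecord F N (rePinH θ).ν (rePinH θ).τ9.M (gOfRecord₁₃ F N (rePinH θ).toStage13Params p) p.K k s'.init U *
          tkBranchOfRecord F N (FluctV N) (rePinH θ).ν (rePinH θ).τ9.M (gOfRecord₁₃ F N (rePinH θ).toStage13Params p) p.K (WtOfRecord₁₃H F N (rePinH θ) p s'.init) s'.init S₀ k
            (fun ω => (sect2Operand F N (FluctV N) p.K (settingOfRecord₁₃ F N (rePinH θ).toStage13Params p) ((rePinH θ).rzAt p s'.init) s'.init (t s'.init) (Ek s'.init)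
            (UbgOfRecord₁₃CoP F N (rePinH θ).toStage13Params p k s'.init)) (S₀, fun j => (ω j).2) (fun j => (ω j).1)) (baseCfg k U))) ∘
            ⇑(MeasurableEquiv.piEquivPiSubtypeProd (fun _ : PBond (F.P p.K) k => SU N)
            (· ∈ (Set.toFinite (bondsIn k (s'.Ω (k + 1))ᶜ)).toFinset)).symm) (y, extend (fun c : {c : PBond (F.P p.K) (k + 1) // c ∉ (Set.toFinite (bondsIn (k + 1) (s'.Ω (k + 1))ᶜ)).toFinset} =>
            (⟨centralBond (c : PBond (F.P p.K) (k + 1)), hβ' c c.2⟩ : {b : PBond (F.P p.K) k // b ∉ (Set.toFinite (bondsIn k (s'.Ω (k + 1))ᶜ)).toFinset}))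
            (fun c : {c : PBond (F.P p.K) (k + 1) // c ∉ (Set.toFinite (bondsIn (k + 1) (s'.Ω (k + 1))ᶜ)).toFinset} => ϑ c ((MeasurableEquiv.piEquivPiSubtypeProd (fun _ : PBond (F.P p.K) k => SU N) (· ∈ (Set.toFinite (bondsIn k (s'.Ω (k + 1))ᶜ)).toFinset)).symm (y, r)) (q.2 c)) r) ∂(Measure.pi fun _ : {b : PBond (F.P p.K) k // b ∉ (Set.toFinite (bondsIn k (s'.Ω (k + 1))ᶜ)).toFinset} => (HaarData.haar : Measure (SU N)))) =
          ∑ Y ∈ (Set.toFinite {Y : Set (Site (F.P p.K) 0) | Y ∈ SClassOfRecord F (rePinH θ).ν (gOfRecord₁₃ F N (rePinH θ).toStage13Params p) p.K (k + 1) ∧ Y ⊆ s'.Ω (k + 1) ∩ (s'.Λ (k + 1))ᶜ}).toFinset,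
            zetaOp (genDataOfRecord F N (FluctV N) (rePinH θ).ν (rePinH θ).τ9.M (gOfRecord₁₃ F N (rePinH θ).toStage13Params p) p.K (WtOfRecord₁₃H F N (rePinH θ) p s') s' (Function.update S₀ (k + 1) Y) k).ζ
              (aOp k (genDataOfRecord F N (FluctV N) (rePinH θ).ν (rePinH θ).τ9.M (gOfRecord₁₃ F N (rePinH θ).toStage13Params p) p.K (WtOfRecord₁₃H F N (rePinH θ) p s') s' (Function.update S₀ (k + 1) Y) k).sA
                (genDataOfRecord F N (FluctV N) (rePinH θ).ν (rePinH θ).τ9.M (gOfRecord₁₃ F N (rePinH θ).toStage13Params p) p.K (WtOfRecord₁₃H F N (rePinH θ) p s') s' (Function.update S₀ (k + 1) Y) k).w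
                (tkBranchOfRecord F N (FluctV N) (rePinH θ).ν (rePinH θ).τ9.M (gOfRecord₁₃ F N (rePinH θ).toStage13Params p) p.K (WtOfRecord₁₃H F N (rePinH θ) p s') s'.init S₀ k
                  (fun ω => (sect2Operand F N (FluctV N) p.K (settingOfRecord₁₃ F N (rePinH θ).toStage13Params p) ((rePinH θ).rzAt p s') s' (graftAboveB k (t s'.init) u) E'
                  (UbgOfRecord₁₃CoP F N (rePinH θ).toStage13Params p (k + 1) s')) (Function.update S₀ (k + 1) Y, fun j => (ω j).2) (fun j => (ω j).1))))
              (Function.update (baseCfg (k + 1) ((MeasurableEquiv.piEquivPiSubtypeProd (fun _ : PBond (F.P p.K) (k + 1) => SU N)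
                (· ∈ (Set.toFinite (bondsIn (k + 1) (s'.Ω (k + 1))ᶜ)).toFinset)).symm q)) k
              (Function.updateFinset ((baseCfg (V := FluctV N) (k + 1) ((MeasurableEquiv.piEquivPiSubtypeProd (fun _ : PBond (F.P p.K) (k + 1) => SU N)
                (· ∈ (Set.toFinite (bondsIn (k + 1) (s'.Ω (k + 1))ᶜ)).toFinset)).symm q)) k).1 (Set.toFinite (bondsIn k (s'.Ω (k + 1))ᶜ)).toFinset y,
                ((baseCfg (V := FluctV N) (k + 1) ((MeasurableEquiv.piEquivPiSubtypeProd (fun _ : PBond (F.P p.K) (k + 1) => SU N)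
                (· ∈ (Set.toFinite (bondsIn (k + 1) (s'.Ω (k + 1))ᶜ)).toFinset)).symm q)) k).2))) :
    slotsTOfRecord F N (rePinH θ).ν (rePinH θ).τ9 (EOfRecord₁₃ F N (rePinH θ).toStage13Params) (wOfRecord₉ F N (rePinH θ).toStage9Params) (rePinH θ).ppSel p (gOfRecord₁₃ F N (rePinH θ).toStage13Params p) (k + 1) s' = 0 ∨
      ∀ᵐ V' ∂fieldMeasure (F.P p.K) (k + 1) (SU N),
        chiSeqOfRecord F N (rePinH θ).ν (rePinH θ).τ9.M (gOfRecord₁₃ F N (rePinH θ).toStage13Params p) p.K (k + 1) s' V' ≠ 0 →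
          slotsTOfRecord F N (rePinH θ).ν (rePinH θ).τ9 (EOfRecord₁₃ F N (rePinH θ).toStage13Params) (wOfRecord₉ F N (rePinH θ).toStage9Params) (rePinH θ).ppSel p (gOfRecord₁₃ F N (rePinH θ).toStage13Params p) (k + 1) s' V' =
            sect2Slot F N (FluctV N) p.K (settingOfRecord₁₃ F N (rePinH θ).toStage13Params p) ((rePinH θ).rzAt p s') (WtOfRecord₁₃H F N (rePinH θ) p s') s' (graftAboveB k (t s'.init) u) E'
              (UbgOfRecord₁₃CoP F N (rePinH θ).toStage13Params p (k + 1) s') V' :=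
  slotsTOfRecord₁₃H_succ_O3_of_hasSect2FormAtZS_of_privateInnerChart_rePinH_of_termRows θ h p hkK (hdec := hdec) (hdec' := hdec') hk s' hform
    (graftAboveB k (t s'.init) u) E' htrows₀ (termRowsAt_graftAboveB_all k (t s'.init) u htrows₀ hnew) hβ' Ω T ϑ jd hΩm hTm hθm hjm hΩbl hright hlaw hwS hinner₀

end Summit.QuantumFields.YangMills.Theorems.BalabanUVNodesN11TStepOldBranchPrivateInnerChartAtRePinH

end
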